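import Summits.PneNP.PneNP.Theorems.ExpanderLinearGeneratorsTransferPrep
import Summits.PneNP.PneNP.Theses.ExpanderLinearGenerators

/-!
# PneNP / ExpanderLinearGenerators — the crux implies bounded-depth Frege lower bounds for every
unsatisfiable `ℓ`-CNF with expanding clause supports

Route `PneNP/ExpanderLinearGenerators`, crux stmt-PneNP-11443
(`Summit.PneNP.PneNP.Theses.ExpanderLinearGenerators.LinearGeneratorDepthFregeHard`, Krajíček's
Problem 19.4.5 in universal-expander form). A CALIBRATION of the open core of the crux (its
column-weight-`≥ 3` case, `linearGeneratorDepthFregeHard_iff_three_le_colWeight`): the crux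
implies an exponential lower bound for depth-`d` `textbookFrege` refutations of EVERY
unsatisfiable `ℓ`-CNF on `n` variables whose clause supports (pairwise distinct, as forced by
expansion) form an `(n^{1-δ}, 3ℓ/4)`-boundary expander. Random `ℓ`-CNFs with `Θ(n)` clauses above
the satisfiability threshold are such CNFs with high probability (Chvátal–Szemerédi), and proving
super-polynomial bounded-depth Frege lower bounds for them is a long-standing open problem (the
best bound in print is `Ω(n^{1+ε_d})` steps, Gryaznov–Talebanfard 2024, whose abstract calls the
super-polynomial bound "a major open problem in proof complexity"). So the column-weight-`≥ 3`
case of the crux is at least as hard as that problem.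

The reduction: a clause `C` with variable set `V` forbids exactly one assignment `α_C` of `V`;
the `𝔽₂`-equation `Σ_{x ∈ V} x = 1 + |{negative literals of C}|` is violated by `α_C`, so its
canonical CNF contains (a clause equivalent to) `C`. The system `E_F` of these equations, one per
clause of `F`, has the supports of `F`, is unsolvable when `F` is unsatisfiable, and a depth-`d`
refutation of `F` is moved onto `sumEncoding 1 E_F` by GIRS's transfer lemma with the identity
substitution (`LinGen.exists_xorProof_of_rowLocal`), at polynomial cost.

* `clause_eval_of_holds` — an assignment satisfying the equation of `C` satisfies `C`;
* `not_systemSat_of_not_satisfiable` — `F` unsatisfiable ⇒ `E_F` unsolvable;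
* `expandingCNF_depthFregeHard_of_linearGeneratorDepthFregeHard` — the calibration.

References: J. Krajíček, *Proof complexity* (CUP 2019), Problem 19.4.5; V. Chvátal, E. Szemerédi,
*Many hard examples for resolution*, JACM 35 (1988); S. Gryaznov, N. Talebanfard, *Bounded-depth
Frege lower bounds for random 3-CNFs via deterministic restrictions*, arXiv:2403.02275 (2024);
N. Galesi, D. Itsykson, A. Riazanov, A. Sofronova, APAL 174 (2023), Lemma 10.
-/

namespace Summit.PneNP.PneNP.Theorems.LinGen

open Filter Finset Literature.Computability.MetaComplexity
open Literature.Computability.MetaComplexity.TextbookFrege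
open Literature.Computability.Complexity (PropForm Clause CNF Literal)
open Literature.Computability.Complexity.PropForm
open Literature.Computability.MetaComplexity.KrajicekRamsey (clauseOf ofCNF_eq_conjList)
open Summit.PneNP.PneNP.Theorems.GridRouting Summit.PneNP.PneNP.Theorems.ColumnTwo

variable {n : ℕ}

/-! ### The parity equation of a clause -/

section Clause

variable {c : Clause ℕ} {e : LinEqMod 2 n}
  (he : ∀ j : Fin n, e.1 j = if (j : ℕ) ∈ c.map Prod.fst then 1 else 0)

include he

/-- The support of the equation of a clause is the set of its variables. [folklore] -/
theorem mem_supp_iff_of_clause (j : Fin n) : j ∈ e.supp ↔ (j : ℕ) ∈ c.map Prod.fst := by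
  simp only [LinEqMod.supp, Finset.mem_filter, Finset.mem_univ, true_and, he j]
  by_cases h : (j : ℕ) ∈ c.map Prod.fst <;> simp [h]

/-- As sets of numbers, the support of the equation of a clause (all of whose variables are
`< n`) is the set of its variables. [folklore] -/
theorem supp_map_of_clause (hcn : ∀ l ∈ c, l.1 < n) :
    e.supp.map Fin.valEmbedding = (c.map Prod.fst).toFinset := by
  ext x
  simp only [Finset.mem_map, Fin.valEmbedding_apply, List.mem_toFinset]
  constructor
  · rintro ⟨j, hj, rfl⟩
    exact (mem_supp_iff_of_clause he j).1 hj
  · intro hx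
    obtain ⟨l, hl, rfl⟩ := List.mem_map.1 hx
    exact ⟨⟨l.1, hcn l hl⟩, (mem_supp_iff_of_clause he _).2 hx, rfl⟩

/-- The equation of a clause of width `≤ ℓ` is `ℓ`-sparse. [folklore] -/
theorem card_supp_le_of_clause (hcn : ∀ l ∈ c, l.1 < n) : e.supp.card ≤ c.length := by
  rw [← Finset.card_map Fin.valEmbedding, supp_map_of_clause he hcn]
  exact (List.toFinset_card_le _).trans (by rw [List.length_map])

/-- The variables of (the rendering of) a clause are Boolean variables of its equation.
[folklore] -/
theorem mem_eqVars_of_clause (hcn : ∀ l ∈ c, l.1 < n) {x : ℕ} (hx : x ∈ (clauseOf c).vars) :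
    x ∈ eqVars 1 e := by
  obtain ⟨l, hl, rfl⟩ := exists_literal_of_mem_vars_clauseOf hx
  refine mem_eqVars.2 ⟨⟨l.1, hcn l hl⟩, ?_, mem_encBlock.2 ⟨0, one_pos, by simp⟩⟩
  exact (mem_supp_iff_of_clause he _).2 (List.mem_map.2 ⟨l, hl, rfl⟩)

/-- **An assignment satisfying the equation of a clause satisfies the clause.** The equation
`Σ_{x ∈ V} x = 1 + |negative literals|` is violated by the unique assignment of `V` falsifying
`C` (every literal false: `τ x = ¬ polarity`), so an assignment satisfying it satisfies `C`.
[folklore] -/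
theorem clause_eval_of_holds (hc : (c.map Prod.fst).Nodup) (hcn : ∀ l ∈ c, l.1 < n)
    (hb : e.2 = (c.map fun l => if l.2 then (0 : ZMod 2) else 1).sum + 1) (τ : ℕ → Bool)
    (hhold : e.Holds (blockVals 2 1 n τ)) : Clause.eval τ c = true := by
  by_contra hfalse
  rw [Bool.not_eq_true] at hfalse
  -- every literal is false
  have hlit : ∀ l ∈ c, τ l.1 = !l.2 := by
    intro l hl
    have h1 : Literal.eval τ l = false := by
      rw [Clause.eval, List.any_eq_false] at hfalse
      simpa using hfalse l hl
    unfold Literal.eval at h1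
    cases h2 : τ l.1 <;> cases h3 : l.2 <;> simp_all
  -- the sum of the equation, over the clause
  rw [holds_blockVals_iff, sum_coeff_mul, hb] at hhold
  have hsum : ∑ j ∈ e.supp, (if τ (j : ℕ) then (1 : ZMod 2) else 0) =
      (c.map fun l => if l.2 then (0 : ZMod 2) else 1).sum := by
    have h1 : ∑ j ∈ e.supp, (if τ (j : ℕ) then (1 : ZMod 2) else 0) =
        ∑ x ∈ e.supp.map Fin.valEmbedding, (if τ x then (1 : ZMod 2) else 0) := by
      rw [Finset.sum_map]; rfl
    rw [h1, supp_map_of_clause he hcn, List.sum_toFinset _ hc, List.map_map]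
    congr 1
    refine List.map_congr_left fun l hl => ?_
    simp only [Function.comp_apply, hlit l hl]
    cases l.2 <;> simp
  rw [hsum] at hhold
  have : (0 : ZMod 2) = 1 := by
    have h := hhold
    generalize (c.map fun l => if l.2 then (0 : ZMod 2) else 1).sum = s at h
    revert s; decide
  exact absurd this (by decide)

end Clause

/-! ### Unsatisfiable CNF ⇒ unsolvable system -/

/-- **If `F` is unsatisfiable then its system of clause equations is unsolvable**: a solution
`z` of the system, read as a Boolean assignment, satisfies every clause by
`clause_eval_of_holds`. [folklore] -/
theorem not_systemSat_of_not_satisfiable {m : ℕ} {C : Fin m → Clause ℕ}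
    {E : Fin m → LinEqMod 2 n}
    (he : ∀ i (j : Fin n), (E i).1 j = if (j : ℕ) ∈ (C i).map Prod.fst then 1 else 0)
    (hb : ∀ i, (E i).2 = ((C i).map fun l => if l.2 then (0 : ZMod 2) else 1).sum + 1)
    (hc : ∀ i, ((C i).map Prod.fst).Nodup) (hcn : ∀ i, ∀ l ∈ C i, l.1 < n)
    (hunsat : ¬ CNF.Satisfiable (List.ofFn C)) : ¬ SystemSat E Finset.univ := by
  rintro ⟨z, hz⟩
  apply hunsat
  -- the Boolean reading of `z`
  let τ : ℕ → Bool := fun x => if h : x < n then decide (z ⟨x, h⟩ = 1) else false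
  have hτ : blockVals 2 1 n τ = z := by
    rw [OntoPHPReduction.blockVals_one]
    funext j
    have h01 : ∀ a : ZMod 2, a = 0 ∨ a = 1 := by decide
    simp only [τ, j.2, dif_pos, Fin.eta]
    rcases h01 (z j) with h | h <;> simp [h]
  refine ⟨τ, (CNF.eval_eq_true_iff _ _).2 fun c hcm => ?_⟩
  obtain ⟨i, rfl⟩ := List.mem_ofFn.1 hcm
  have hhold : (E i).Holds (blockVals 2 1 n τ) := by rw [hτ]; exact hz i (Finset.mem_univ _)
  exact clause_eval_of_holds (he i) (hc i) (hcn i) (hb i) τ hhold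

/-! ### The calibration -/

/-- **The crux implies bounded-depth Frege lower bounds for all unsatisfiable expanding
`ℓ`-CNFs.** Assume `LinearGeneratorDepthFregeHard`. Then for every `ℓ ≥ 1`, `0 < δ < 1` and
depth `d` there are `ε > 0` and `N` such that for `n ≥ N`: if `C₀, …, C_{m-1}` are clauses of
width `≤ ℓ` over the variables `< n`, each with distinct variables, whose variable sets form an
`(n^{1-δ}, 3ℓ/4)`-boundary expander, and the CNF `F = [C₀, …, C_{m-1}]` is unsatisfiable, then
every depth-`d` `textbookFrege` proof of `¬ F` has size `≥ 2^{n^ε}`. (Random `ℓ`-CNFs of linear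
size are such `F` w.h.p.; super-polynomial bounded-depth Frege lower bounds for them are open —
Gryaznov–Talebanfard 2024 prove `Ω(n^{1+ε_d})` steps.) Proof: XOR-embedding of `F` into the
`ℓ`-sparse expanding unsolvable system of its clause equations, GIRS transfer with the identity
substitution, and the crux at depth `d + 16`. [Krajíček 2019, Problem 19.4.5;
Gryaznov–Talebanfard 2024 (status of the random-CNF case); Galesi et al. 2023, Lemma 10] -/
theorem expandingCNF_depthFregeHard_of_linearGeneratorDepthFregeHard
    (hX : Summit.PneNP.PneNP.Theses.ExpanderLinearGenerators.LinearGeneratorDepthFregeHard) :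
    ∀ (ℓ d : ℕ) (δ : ℝ), 1 ≤ ℓ → 0 < δ → δ < 1 → ∃ ε : ℝ, 0 < ε ∧ ∃ N : ℕ, ∀ n : ℕ, N ≤ n →
      ∀ (m : ℕ) (C : Fin m → Clause ℕ),
      (∀ i, ((C i).map Prod.fst).Nodup) → (∀ i, ∀ l ∈ C i, l.1 < n) →
      (∀ i, (C i).length ≤ ℓ) →
      IsBoundaryExpander (fun i => ((C i).map Prod.fst).toFinset) ((n : ℝ) ^ (1 - δ)) (3 / 4 * ℓ) →
      ¬ CNF.Satisfiable (List.ofFn C) →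
      ∀ π : List (PropForm ℕ),
        textbookFrege.IsDepthProofOf d π (PropForm.neg (PropForm.ofCNF (List.ofFn C))) →
          (2 : ℝ) ^ ((n : ℝ) ^ ε) ≤ (proofSize π : ℝ) := by
  unfold Summit.PneNP.PneNP.Theses.ExpanderLinearGenerators.LinearGeneratorDepthFregeHard at hX
  intro ℓ d δ hℓ hδ hδ1
  obtain ⟨ε, hε, N₁, hN₁⟩ := hX ℓ (d + 16) δ hℓ hδ hδ1
  obtain ⟨Cst, hCst, hbound⟩ := transferBound_poly (2 ^ ℓ) ℓ
  set W : ℕ := 2 ^ ℓ * (3 * ℓ + 2) with hW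
  obtain ⟨N₂, hN₂⟩ := eventually_atTop.1 (eventually_lb_params (Cst * (W + 2) ^ 3) hε)
  refine ⟨ε / 2, by positivity, max N₁ N₂, ?_⟩
  intro n hn m C hc hcn hlen hexp hunsat π hπ
  obtain ⟨-, hc2, h4, hn1⟩ := hN₂ n (le_trans (le_max_right _ _) hn)
  classical
  -- the system of clause equations
  set E : Fin m → LinEqMod 2 n := fun i =>
    (fun j => if (j : ℕ) ∈ (C i).map Prod.fst then 1 else 0,
      ((C i).map fun l => if l.2 then (0 : ZMod 2) else 1).sum + 1) with hE
  have he : ∀ i (j : Fin n), (E i).1 j = if (j : ℕ) ∈ (C i).map Prod.fst then 1 else 0 :=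
    fun i j => rfl
  have hb : ∀ i, (E i).2 = ((C i).map fun l => if l.2 then (0 : ZMod 2) else 1).sum + 1 :=
    fun i => rfl
  have hℓ' : ∀ i, (E i).supp.card ≤ ℓ := fun i =>
    (card_supp_le_of_clause (he i) (hcn i)).trans (hlen i)
  have hexp' : IsBoundaryExpander (fun i => (E i).supp.map Fin.valEmbedding) ((n : ℝ) ^ (1 - δ))
      (3 / 4 * ℓ) := by
    have : (fun i => (E i).supp.map Fin.valEmbedding) = fun i => ((C i).map Prod.fst).toFinset :=
      funext fun i => supp_map_of_clause (he i) (hcn i)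
    rw [this]
    exact hexp
  have hunsat' : ¬ SystemSat E Finset.univ := not_systemSat_of_not_satisfiable he hb hc hcn hunsat
  -- transfer of the refutation
  obtain ⟨π', hπ', hsize⟩ := exists_xorProof_of_rowLocal (List.ofFn C) E PropForm.var
    (fun x => by simp [size]) (fun x c => by simp [altDepthAux]) hℓ' hπ (by
      intro c hcm
      obtain ⟨i, rfl⟩ := List.mem_ofFn.1 hcm
      refine ⟨i, fun x hx => ?_, fun τ hτ => ?_⟩
      · rw [subst_var] at hx
        exact mem_eqVars_of_clause (he i) (hcn i) hx
      · rw [subst_var, OntoPHPReduction.eval_clauseOf]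
        exact clause_eval_of_holds (he i) (hc i) (hcn i) (hb i) τ hτ)
  -- the crux, applied to the system
  have hlb := hN₁ n (le_trans (le_max_left _ _) hn) m E hℓ' hexp' hunsat' π' hπ'
  -- sizes
  set S := proofSize π with hS
  have hmS : m ≤ S := by
    have := length_le_proofSize_of_refutes hπ
    rwa [List.length_ofFn] at this
  have hsz : proofSize π' ≤ Cst * ((W + 1) * S + 0 + 3) ^ 3 := by
    refine hsize.trans ((hbound S (S + m * W) (Nat.le_add_right _ _)).trans ?_)
    refine Nat.mul_le_mul_left _ (Nat.pow_le_pow_left ?_ 3)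
    have := Nat.mul_le_mul_right W hmS
    nlinarith
  refine lb_of_poly (ε := ε) (ε' := ε / 2) (T := Cst) (a := W + 1) (b := 0) hlb hsz ?_ ?_ h4
  · have h8 : (3 : ℝ) ≤ (Cst * (W + 2) ^ 3 : ℕ) := by
      have : 3 ≤ Cst * (W + 2) ^ 3 :=
        le_trans (by norm_num) (Nat.mul_le_mul hCst (Nat.pow_le_pow_left (show 2 ≤ W + 2 by omega) 3))
      exact_mod_cast this
    push_cast at hc2 h8 ⊢
    linarith
  · have : ((Cst : ℝ) * (((W + 1 : ℕ) : ℝ) + 1) ^ 3) = ((Cst * (W + 2) ^ 3 : ℕ) : ℝ) := by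
      push_cast; ring
    rw [this]
    exact hc2

end Summit.PneNP.PneNP.Theorems.LinGen
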